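import Summits.QuantumFields.YangMills.Theorems.SwapVirialDeficitSectorLaplaceEndShellLetters
import Summits.QuantumFields.YangMills.Theorems.SwapVirialDeficitBlowUpGnomonicHubAngleLetters
import Mathlib.Analysis.SpecialFunctions.ImproperIntegrals
import Mathlib.MeasureTheory.Integral.IntegralEqImproper
import HarnessLib

/-!
# Route `SwapVirialDeficit` (YangMills): THE `δ`-INTEGRATION LAYER OF T-N6b — TIP-MID AGAINST THE ADJACENT SHELL FROM A POINTWISE SANDWICH, WITHOUT FUBINI
# (cell ym-idea-1, skeleton ➎, `stub_core_tip`; w2 g60 memo3 §§3, 5 ∕ LEAD g99 23:11Z: the tip-mid ∕ shell share is `≲ sup_p √R(p)·√τ∕r`;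
# free-hands support of ⟨stmt-QuantumFields-24197⟩ `SwapVirialDeficit.SwapGluedStiffness`)

In the hub letter `δ = cot θ` both the tip-mid slab and the adjacent shell are `δ`-integrals of `((1+δ²)⁻¹)²·F(δ)`, `F(δ) = (2π/b)^α∫_{Box}𝔪(hubAt δ 1, ε, p) dp` (bulk law on
both sides: ✓`hubIntegral_hubAt_two_sided`, ✓`mbMain_ge_of_subset`, ✓`tipWindow_eq_integral_hubIntegral`).  The Hessian sandwich (tip ✓∕⧗`mbDensity_le_floorDet` (w2 g61),
shell ✓`mbDensity_hubAt_ge_softCeil`) is a POINTWISE-in-`p` comparability `𝔪(hubAt δt 1, p)·δs ≤ R·(1+δt²)·𝔪(hubAt δs 1, p)` (tip-mid `δt`, shell `δs`: one soft pair on each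
side).  This file turns any such pointwise law into the integrated share WITHOUT swapping integrals: average the law over the shell letter `δs` against `δs(1+δs²)⁻²`
(exact mass `W = ((1+a²)⁻¹ − (1+c²)⁻¹)/2` on `Icc a c`), then integrate the tip letter against `(1+δt²)⁻¹ ≤` (mass `≤ δ₁⁻¹` beyond `δ₁`):
* §1 `integral_Ioi_inv_one_add_sq` (`∫_{Ioi a}(1+x²)⁻¹ = π/2 − arctan a`), `setIntegral_inv_one_add_sq_le_inv` (`≤ a⁻¹` on any `S ⊆ Ioi a`, `a > 0`),
  `integral_Icc_mul_inv_one_add_sq_sq` (`∫_{Icc a c} x·((1+x²)⁻¹)² = ((1+a²)⁻¹ − (1+c²)⁻¹)/2`);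
* §2 ★★ `integral_mid_le_shell_of_pointwise` — for `F ≥ 0` with `F(δt)·δs ≤ R(1+δt²)F(δs)` (`δt ∈ Mid ⊆ Ioi δ₁`, `δs ∈ Icc a c`, `0 < a < c`) and the shell integrand integrable:
  `∫_{Mid} ((1+δ²)⁻¹)²F ≤ R/(δ₁·W) · ∫_{Icc a c} ((1+δ²)⁻¹)²F`;
* §3 ★★ `tipMid_le_shell_of_pointwise` — the same for `F(δ) = ∫_{Box}𝔪(hubAt δ 1, ε, p) dp` from the POINTWISE-in-`p` law (H′).
With `δ₁ = δ_τ = √(τ⁻¹ − 1) ≍ τ^{−1/2}`, `a = cot r`, `c = δ_τ`: `W ≍ r²/2` and the share is `≍ 2R√τ/r²` (memo3 §5).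

HONEST LABEL: real analysis; the pointwise law (H′) (sandwich + follower-determinant matching), tip-core, corner, ends and the assembly of `hT` remain; `stub_core_tip`,
⟨24197⟩ ∕ ⟨24194⟩ OPEN; own crux ⟨22884⟩ `LargeFieldMassRefinementTail` OPEN (blocked-on ⟨19935⟩); the Yang–Mills mass gap is NOT proved; no summit is proved by a line.
THEOREMS ONLY (0 `def`, 0 `sorry`, no instance), standard axioms.  Width seat ym-line-sfw-p2-w3 g68 (cell ym-idea-1, free hands), `--supports stmt-QuantumFields-24197`.
References: [folklore].
-/

set_option autoImplicit false
set_option synthInstance.maxSize 1024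

noncomputable section

open MeasureTheory Quaternion Set Filter
open scoped Quaternion BigOperators ENNReal Topology
open Literature.MathematicalPhysics.QuantumLattice
open Literature.MathematicalPhysics.QuantumFieldTheory hiding SU2
open Summit.QuantumFields.YangMills.Theorems.SwapTwistDeficit.ToronLog

namespace Summit.QuantumFields.YangMills.Theorems.SwapVirialDeficit.SectorLaplace

open Summit.QuantumFields.YangMills.Theorems.FemtoTransferGap
open Summit.QuantumFields.YangMills.Theorems.FemtoTransferGap.TT
open Summit.QuantumFields.YangMills.Theorems.VirialFluxGap.RingDeficit
open Summit.QuantumFields.YangMills.Theorems.SwapVirialDeficit.SwapRing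
open Summit.QuantumFields.YangMills.Theorems.SwapVirialDeficit.BlowUpRing

variable {L : ℕ} [NeZero L]

/-! ## §1 Two hub-letter integrals -/

omit [NeZero L] in
/-- `∫_{Ioi a} (1+x²)⁻¹ dx = π/2 − arctan a`. [folklore] -/
theorem integral_Ioi_inv_one_add_sq (a : ℝ) : ∫ x in Ioi a, (1 + x ^ 2)⁻¹ = Real.pi / 2 - Real.arctan a := by
  have hderiv : ∀ x ∈ Ioi a, HasDerivAt Real.arctan ((1 + x ^ 2)⁻¹) x := fun x _ => by
    have h := Real.hasDerivAt_arctan x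
    rwa [one_div] at h
  exact integral_Ioi_of_hasDerivAt_of_tendsto (Real.continuous_arctan.continuousWithinAt) hderiv integrable_inv_one_add_sq.integrableOn
    (Real.tendsto_arctan_atTop.mono_right nhdsWithin_le_nhds)

omit [NeZero L] in
/-- `∫_S (1+x²)⁻¹ dx ≤ a⁻¹` for measurable `S ⊆ Ioi a`, `a > 0` (`π/2 − arctan a = arctan a⁻¹ ≤ a⁻¹`). [folklore] -/
theorem setIntegral_inv_one_add_sq_le_inv {a : ℝ} (ha : 0 < a) {S : Set ℝ} (hS : S ⊆ Ioi a) :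
    ∫ x in S, (1 + x ^ 2)⁻¹ ≤ a⁻¹ := by
  calc ∫ x in S, (1 + x ^ 2)⁻¹ ≤ ∫ x in Ioi a, (1 + x ^ 2)⁻¹ :=
        setIntegral_mono_set integrable_inv_one_add_sq.integrableOn (Eventually.of_forall fun x => by positivity) (Eventually.of_forall hS)
    _ = Real.pi / 2 - Real.arctan a := integral_Ioi_inv_one_add_sq a
    _ = Real.arctan a⁻¹ := by rw [Real.arctan_inv_of_pos ha]
    _ ≤ a⁻¹ := by
        have h := abs_arctan_sub_arctan_le a⁻¹ 0
        rw [Real.arctan_zero, sub_zero, sub_zero, abs_of_pos (inv_pos.2 ha)] at h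
        exact (le_abs_self _).trans h

omit [NeZero L] in
/-- `∫_{Icc a c} x·((1+x²)⁻¹)² dx = ((1+a²)⁻¹ − (1+c²)⁻¹)/2` for `a ≤ c` (antiderivative `−(1+x²)⁻¹/2`). [folklore] -/
theorem integral_Icc_mul_inv_one_add_sq_sq {a c : ℝ} (hac : a ≤ c) :
    ∫ x in Icc a c, x * ((1 + x ^ 2)⁻¹) ^ 2 = ((1 + a ^ 2)⁻¹ - (1 + c ^ 2)⁻¹) / 2 := by
  rw [integral_Icc_eq_integral_Ioc, ← intervalIntegral.integral_of_le hac]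
  have hderiv : ∀ x ∈ uIcc a c, HasDerivAt (fun x : ℝ => -(1 + x ^ 2)⁻¹ / 2) (x * ((1 + x ^ 2)⁻¹) ^ 2) x := by
    intro x _
    have h1 : HasDerivAt (fun x : ℝ => 1 + x ^ 2) (2 * x) x := by
      have h := (hasDerivAt_pow 2 x).const_add 1
      simpa using h
    have hpos : (1 + x ^ 2) ≠ 0 := by positivity
    have h2 := (h1.inv hpos).neg.div_const 2
    refine h2.congr_deriv ?_
    field_simp
  have hinv : Continuous fun x : ℝ => (1 + x ^ 2)⁻¹ :=
      Continuous.inv₀ (f := fun x : ℝ => 1 + x ^ 2) (by fun_prop) (fun x => by show (1 + x ^ 2 : ℝ) ≠ 0; positivity)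
  have hcont : ContinuousOn (fun x : ℝ => x * ((1 + x ^ 2)⁻¹) ^ 2) (uIcc a c) := (continuous_id.mul (hinv.pow 2)).continuousOn
  rw [intervalIntegral.integral_eq_sub_of_hasDerivAt hderiv (hcont.intervalIntegrable)]
  ring

/-! ## §2 The integration layer for an abstract non-negative `δ`-density -/

omit [NeZero L] in
/-- ★★ **TIP-MID AGAINST SHELL FROM A POINTWISE LAW, NO FUBINI.**  Let `F ≥ 0` on `Mid ∪ Icc a c`, `Mid ⊆ Ioi δ₁` measurable (`δ₁ > 0`), `0 < a < c`, `R ≥ 0`, with the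
pointwise law `F δt · δs ≤ R·(1 + δt²)·F δs` for `δt ∈ Mid`, `δs ∈ Icc a c` (`c ≤ δ₁`, so `δs ≤ δt`), and `((1+δ²)⁻¹)²·F` integrable on `Icc a c`.  Then
`∫_{Mid} ((1+δ²)⁻¹)²·F ≤ R/(δ₁·W)·∫_{Icc a c} ((1+δ²)⁻¹)²·F`, `W = ((1+a²)⁻¹ − (1+c²)⁻¹)/2 > 0`. [folklore] -/
theorem integral_mid_le_shell_of_pointwise {F : ℝ → ℝ} {Mid : Set ℝ} (hMid : MeasurableSet Mid) {δ₁ : ℝ} (hδ₁ : 0 < δ₁) (hMid₁ : Mid ⊆ Ioi δ₁)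
    {a c : ℝ} (ha : 0 < a) (hac : a < c) (hcδ : c ≤ δ₁) {R : ℝ} (hR : 0 ≤ R) (hF0 : ∀ δ ∈ Mid, 0 ≤ F δ) (hF0' : ∀ δ ∈ Icc a c, 0 ≤ F δ)
    (H : ∀ δt ∈ Mid, ∀ δs ∈ Icc a c, δs ≤ δt → F δt * δs ≤ R * (1 + δt ^ 2) * F δs)
    (hS : IntegrableOn (fun δ => ((1 + δ ^ 2)⁻¹) ^ 2 * F δ) (Icc a c)) :
    ∫ δ in Mid, ((1 + δ ^ 2)⁻¹) ^ 2 * F δ ≤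
      R / (δ₁ * (((1 + a ^ 2)⁻¹ - (1 + c ^ 2)⁻¹) / 2)) * ∫ δ in Icc a c, ((1 + δ ^ 2)⁻¹) ^ 2 * F δ := by
  set W : ℝ := ((1 + a ^ 2)⁻¹ - (1 + c ^ 2)⁻¹) / 2 with hW
  set B : ℝ := ∫ δ in Icc a c, ((1 + δ ^ 2)⁻¹) ^ 2 * F δ with hB
  have hW0 : 0 < W := by
    rw [hW]
    have h : (1 + c ^ 2)⁻¹ < (1 + a ^ 2)⁻¹ := by
      apply inv_strictAnti₀ (by positivity)
      nlinarith [mul_pos ha (by linarith : (0 : ℝ) < c)]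
    linarith
  have hB0 : 0 ≤ B := by
    rw [hB]; exact setIntegral_nonneg measurableSet_Icc fun δ hδ => mul_nonneg (by positivity) (hF0' δ hδ)
  -- step 1: average the law over the shell letter, for each tip letter
  have hstep : ∀ δt ∈ Mid, ((1 + δt ^ 2)⁻¹) ^ 2 * F δt * W ≤ R * (1 + δt ^ 2)⁻¹ * B := by
    intro δt hδt
    have ht1 : 0 < 1 + δt ^ 2 := by positivity
    -- integrate `((1+δt²)⁻¹)² F(δt) · δs((1+δs²)⁻¹)² ≤ R (1+δt²)⁻¹ · ((1+δs²)⁻¹)² F(δs)` over `δs ∈ Icc a c`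
    have hpt : ∀ δs ∈ Icc a c, ((1 + δt ^ 2)⁻¹) ^ 2 * F δt * (δs * ((1 + δs ^ 2)⁻¹) ^ 2) ≤ R * (1 + δt ^ 2)⁻¹ * (((1 + δs ^ 2)⁻¹) ^ 2 * F δs) := by
      intro δs hδs
      have h := H δt hδt δs hδs ((hδs.2.trans hcδ).trans (le_of_lt (hMid₁ hδt)))
      have hw : 0 ≤ ((1 + δs ^ 2)⁻¹) ^ 2 := by positivity
      have e1 : ((1 + δt ^ 2)⁻¹) ^ 2 * F δt * (δs * ((1 + δs ^ 2)⁻¹) ^ 2) = ((1 + δt ^ 2)⁻¹) ^ 2 * ((1 + δs ^ 2)⁻¹) ^ 2 * (F δt * δs) := by ring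
      have e2 : R * (1 + δt ^ 2)⁻¹ * (((1 + δs ^ 2)⁻¹) ^ 2 * F δs) = ((1 + δt ^ 2)⁻¹) ^ 2 * ((1 + δs ^ 2)⁻¹) ^ 2 * (R * (1 + δt ^ 2) * F δs) := by
        field_simp
      rw [e1, e2]
      exact mul_le_mul_of_nonneg_left h (by positivity)
    have hinv : Continuous fun x : ℝ => (1 + x ^ 2)⁻¹ :=
      Continuous.inv₀ (f := fun x : ℝ => 1 + x ^ 2) (by fun_prop) (fun x => by show (1 + x ^ 2 : ℝ) ≠ 0; positivity)
    have hintL : IntegrableOn (fun δs : ℝ => ((1 + δt ^ 2)⁻¹) ^ 2 * F δt * (δs * ((1 + δs ^ 2)⁻¹) ^ 2)) (Icc a c) :=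
      (continuous_const.mul (continuous_id.mul (hinv.pow 2))).integrableOn_Icc
    have hintR : IntegrableOn (fun δs : ℝ => R * (1 + δt ^ 2)⁻¹ * (((1 + δs ^ 2)⁻¹) ^ 2 * F δs)) (Icc a c) := hS.const_mul _
    have hmono := setIntegral_mono_on hintL hintR measurableSet_Icc hpt
    rw [integral_const_mul, integral_const_mul, integral_Icc_mul_inv_one_add_sq_sq hac.le] at hmono
    exact hmono
  -- step 2: integrate the tip letter against `(1+δt²)⁻¹`
  have hpt2 : ∀ δt ∈ Mid, ((1 + δt ^ 2)⁻¹) ^ 2 * F δt ≤ (R * B / W) * (1 + δt ^ 2)⁻¹ := by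
    intro δt hδt
    rw [show (R * B / W) * (1 + δt ^ 2)⁻¹ = R * (1 + δt ^ 2)⁻¹ * B / W by ring]
    exact (le_div_iff₀ hW0).2 (hstep δt hδt)
  have hintg : IntegrableOn (fun δt : ℝ => (R * B / W) * (1 + δt ^ 2)⁻¹) Mid := (integrable_inv_one_add_sq.const_mul _).integrableOn
  have hmono2 : ∫ δ in Mid, ((1 + δ ^ 2)⁻¹) ^ 2 * F δ ≤ ∫ δ in Mid, (R * B / W) * (1 + δ ^ 2)⁻¹ := by
    refine integral_mono_of_nonneg ?_ hintg ?_
    · filter_upwards [ae_restrict_mem hMid] with δ hδ using mul_nonneg (by positivity) (hF0 δ hδ)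
    · filter_upwards [ae_restrict_mem hMid] with δ hδ using hpt2 δ hδ
  rw [integral_const_mul] at hmono2
  have htail := setIntegral_inv_one_add_sq_le_inv hδ₁ hMid₁
  calc ∫ δ in Mid, ((1 + δ ^ 2)⁻¹) ^ 2 * F δ ≤ R * B / W * ∫ δ in Mid, (1 + δ ^ 2)⁻¹ := hmono2
    _ ≤ R * B / W * δ₁⁻¹ := mul_le_mul_of_nonneg_left htail (by positivity)
    _ = R / (δ₁ * W) * B := by field_simp

/-! ## §3 The layer for the Morse–Bott plane mass -/

/-- ★★ **TIP-MID AGAINST SHELL FOR THE MORSE–BOTT PLANE MASS from the pointwise-in-`p` sandwich (H′).**  Windows `Mid ⊆ Ioi δ₁` (measurable, `δ₁ > 0`) and `Icc a c`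
(`0 < a < c`), a measurable `Box ⊆ ℝ²`, `R ≥ 0`; (H′): `𝔪(hubAt δt 1, ε, p)·δs ≤ R·(1+δt²)·𝔪(hubAt δs 1, ε, p)` for `δt ∈ Mid`, `δs ∈ Icc a c` (`c ≤ δ₁`, so only `δs ≤ δt` is asked), `p ∈ Box`; integrability of
`p ↦ 𝔪(hubAt δs 1, ε, p)` on `Box` along the shell and of the shell integrand.  Then
`∫_{Mid} ((1+δ²)⁻¹)²·∫_{Box}𝔪(hubAt δ 1) ≤ R/(δ₁·W)·∫_{Icc a c} ((1+δ²)⁻¹)²·∫_{Box}𝔪(hubAt δ 1)`, `W = ((1+a²)⁻¹ − (1+c²)⁻¹)/2`. [folklore] -/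
theorem tipMid_le_shell_of_pointwise (ε : GnoSign L) {Mid : Set ℝ} (hMid : MeasurableSet Mid) {δ₁ : ℝ} (hδ₁ : 0 < δ₁) (hMid₁ : Mid ⊆ Ioi δ₁)
    {a c : ℝ} (ha : 0 < a) (hac : a < c) (hcδ : c ≤ δ₁) {Box : Set (ℝ × ℝ)} (hBox : MeasurableSet Box) {R : ℝ} (hR : 0 ≤ R)
    (H : ∀ δt ∈ Mid, ∀ δs ∈ Icc a c, δs ≤ δt → ∀ p ∈ Box,
      mbDensity (L := L) (hubAt δt 1) ε p * δs ≤ R * (1 + δt ^ 2) * mbDensity (L := L) (hubAt δs 1) ε p)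
    (hInt : ∀ δs ∈ Icc a c, IntegrableOn (fun p : ℝ × ℝ => mbDensity (L := L) (hubAt δs 1) ε p) Box)
    (hS : IntegrableOn (fun δ : ℝ => ((1 + δ ^ 2)⁻¹) ^ 2 * ∫ p in Box, mbDensity (L := L) (hubAt δ 1) ε p) (Icc a c)) :
    ∫ δ in Mid, ((1 + δ ^ 2)⁻¹) ^ 2 * ∫ p in Box, mbDensity (L := L) (hubAt δ 1) ε p ≤
      R / (δ₁ * (((1 + a ^ 2)⁻¹ - (1 + c ^ 2)⁻¹) / 2)) * ∫ δ in Icc a c, ((1 + δ ^ 2)⁻¹) ^ 2 * ∫ p in Box, mbDensity (L := L) (hubAt δ 1) ε p := by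
  have hF0 : ∀ δ : ℝ, 0 ≤ ∫ p in Box, mbDensity (L := L) (hubAt δ 1) ε p := fun δ =>
    integral_nonneg fun p => mbDensity_nonneg _ ε p
  refine integral_mid_le_shell_of_pointwise hMid hδ₁ hMid₁ ha hac hcδ hR (fun δ _ => hF0 δ) (fun δ _ => hF0 δ) (fun δt hδt δs hδs hle => ?_) hS
  -- integrate (H′) over `p ∈ Box`
  have hδs0 : 0 < δs := lt_of_lt_of_le ha hδs.1
  by_cases hIt : IntegrableOn (fun p : ℝ × ℝ => mbDensity (L := L) (hubAt δt 1) ε p) Box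
  · have h1 : (∫ p in Box, mbDensity (L := L) (hubAt δt 1) ε p) * δs = ∫ p in Box, mbDensity (L := L) (hubAt δt 1) ε p * δs :=
      (integral_mul_const δs _).symm
    have h2 : R * (1 + δt ^ 2) * ∫ p in Box, mbDensity (L := L) (hubAt δs 1) ε p = ∫ p in Box, R * (1 + δt ^ 2) * mbDensity (L := L) (hubAt δs 1) ε p :=
      (integral_const_mul _ _).symm
    rw [h1, h2]
    exact setIntegral_mono_on (hIt.mul_const δs) ((hInt δs hδs).const_mul _) hBox (fun p hp => H δt hδt δs hδs hle p hp)
  · rw [integral_undef hIt, zero_mul]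
    exact mul_nonneg (mul_nonneg hR (by positivity)) (hF0 δs)

end Summit.QuantumFields.YangMills.Theorems.SwapVirialDeficit.SectorLaplace

end
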